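import Summits.RiemannHypothesis.RiemannHypothesis.Theorems.WeilFormatCDataLog4HalfTables
import Summits.RiemannHypothesis.RiemannHypothesis.Theorems.WeilFormatCDataLog3HalfTabValid
import HarnessLib

/-!
# Format C kernel rung `Log4Half` (a = (log 4)/2): validity of the constants, prime data and the table below mode 45 (kernel certificates, part A)

Window `a = (log 4)/2`; prime powers in the window: 2, 3; evaluator parameters S = 2^80, Kpi 70, Kser 96, kred 8, Kexp 24, J 60; full table modes < 98; units 2^-80 (entries), 2^-40 (weights).
Generated by rh-explicit-weil-grh-2 gen9 with rh-explicit-weil-2 gen5's generator UNCHANGED (HOME/rh-explicit-weil-2/gramgen5/gramgen.py + emit5.py, the `Log3Half` parameters) from `#eval` of the tree's `Encl` functions; every datum is re-verified by the kernel in the theorem files (`decide +kernel`: recompute + containment). Helper data of the rh-explicit Weil-positivity programme: the ζ-side table consumed by the twisted format-C χ-cells of the GRH arm at this window (`Summits/Ventures/WeilGRH/CellMod*`), RH-free.  The `π` box `P` is byte-identical to the `Log3Half` rung's, so `WeilFormatCData.Log3Half.pi_mem` is REUSED (no restatement); the window is written out as `Real.log 4 / 2` in the statements (`a` unfolds to it).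 [cite: Yoshida1992HermitianForms, §5 (5.15)-(5.16) p. 301; §7 pp. 305–312]
-/

set_option linter.dupNamespace false
set_option maxRecDepth 200000

namespace Summit.RiemannHypothesis.RiemannHypothesis.Theorems.WeilFormatCData.Log4Half
open Literature.NumberTheory.LFunctions Literature.NumberTheory.LFunctions.Yoshida1992 Encl Literature.Analysis.ValidatedNumerics.NumericsMP

/-- kernel: `A ∋ a`. -/
theorem tA : checkHalfLogNat (2 ^ 80) 96 4 A = true := by decide +kernel

/-- kernel: the prime data of the window. -/
theorem tK : checkPrimeDataHalfLog 4 ks = true := by decide +kernel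

/-- `a ∈ A`. -/
theorem a_mem : MI.mem (2 ^ 80) (Real.log 4 / 2) A :=
  mem_of_checkHalfLogNat (S := 2 ^ 80) (by norm_num) tA

/-- `0 < a` (window written out; `a` unfolds to it). -/
theorem a_pos : (0 : ℝ) < (Real.log 4 / 2) := by
  have : (1 : ℝ) < 4 := by norm_num
  positivity

/-- the constants are valid for `a`. -/
theorem consts_valid : ConstsValid (2 ^ 80) (Real.log 4 / 2) ks C :=
  constsValid_of_checkConsts (prm := prm) (by norm_num [prm]) (by norm_num [prm]) Log3Half.pi_mem a_mem (by decide +kernel)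

/-- the prime data is valid for `a`. -/
theorem primeData : PrimeData (Real.log 4 / 2) ks := by
  have h := primeData_of_checkHalfLog tK
  exact_mod_cast h

/-- kernel: table slice `[0, 8)`. -/
theorem tT0 : checkTable prm C tab 0 8 = true := by decide +kernel

/-- kernel: table slice `[8, 17)`. -/
theorem tT8 : checkTable prm C tab 8 9 = true := by decide +kernel

/-- kernel: table slice `[17, 26)`. -/
theorem tT17 : checkTable prm C tab 17 9 = true := by decide +kernel

/-- kernel: table slice `[26, 35)`. -/
theorem tT26 : checkTable prm C tab 26 9 = true := by decide +kernel

/-- kernel: table slice `[35, 45)`. -/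
theorem tT35 : checkTable prm C tab 35 10 = true := by decide +kernel

/-- the special-value table is valid below `45` (part A; part B = `Log4HalfTabValid`). -/
theorem tab_validA : TabValid (2 ^ 80) a ks 45 tab := by
  have h8 : TabValid (2 ^ 80) a ks (0 + 8) tab :=
    (TabValid.zero (S := 2 ^ 80) (a := a) (ks := ks) (tab := tab)).extend fun n hn hnk ↦ idxValid_of_checkTable (prm := prm) (by norm_num [prm]) a_pos consts_valid tT0 hn hnk
  have h17 : TabValid (2 ^ 80) a ks (8 + 9) tab :=
    h8.extend fun n hn hnk ↦ idxValid_of_checkTable (prm := prm) (by norm_num [prm]) a_pos consts_valid tT8 hn hnk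
  have h26 : TabValid (2 ^ 80) a ks (17 + 9) tab :=
    h17.extend fun n hn hnk ↦ idxValid_of_checkTable (prm := prm) (by norm_num [prm]) a_pos consts_valid tT17 hn hnk
  have h35 : TabValid (2 ^ 80) a ks (26 + 9) tab :=
    h26.extend fun n hn hnk ↦ idxValid_of_checkTable (prm := prm) (by norm_num [prm]) a_pos consts_valid tT26 hn hnk
  have h45 : TabValid (2 ^ 80) a ks (35 + 10) tab :=
    h35.extend fun n hn hnk ↦ idxValid_of_checkTable (prm := prm) (by norm_num [prm]) a_pos consts_valid tT35 hn hnk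
  exact h45

end Summit.RiemannHypothesis.RiemannHypothesis.Theorems.WeilFormatCData.Log4Half
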